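import Literature.Probability.LatticeModels.CriticalTwoPointBounds
import HarnessLib

/-!
# Window for the split child `EtaGainIO` of crux `EtaPositive` (stmt-CriticalPhenomena-2600)

Support file for crux `EtaPositive` of route `AnomalousForcesInteraction` (sub-problem `Ising3DConformalLimit`).
Write `G(x) = ⟨σ₀σ_x⟩⁺_{β_c(3),0}` (`criticalTwoPoint 3`, sup norm on `ℤ³`). The SIGN half of the crux isolated by
the strategist's split (glue p169603),

  `EtaGainIO := ∃ κ > 0, C, ∀ N, ∃ x, N < ‖x‖ ∧ G(x) ≤ C ‖x‖^{-(1+κ)}`,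

asks for a power gain over the infrared bound at SOME far sites only. Calibration of its exponent:

* `etaGainIO_exponent_le_one` — any witness `(κ, C)` of `EtaGainIO` has `κ ≤ 1`: the Simon–Lieb lower bound
  `G(x) ≥ c ‖x‖^{-2}` (`criticalTwoPoint_bounds_holds`, `d = 3`) holds at EVERY site, so a gain past exponent
  `2` is impossible even at a single sequence of sites.

Contrast with the parent: any witness of `EtaPositive` (a gain at ALL sites) has `κ ≤ 1/2`
(`EtaPositive_exponent_le_half`, p165507, from the Duminil-Copin–Panis floor `G(n e₁) ≥ c n^{-3/2}`, which holds
only for infinitely many `n` and therefore does not constrain an i.o. gain). So the child's admissible window is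
`κ ∈ (0, 1]`, the parent's `κ ∈ (0, 1/2]`; conjecturally both are witnessed by every `κ < η(3) ≈ 0.036`.
Standard axioms, no named fact.
-/

namespace Summit.CriticalPhenomena.Ising3DConformalLimit.AnomalousForcesInteractionEtaPositive

open Literature.Probability.LatticeModels

/-- **Window for `EtaGainIO`: `κ ≤ 1`.** If `G(x) ≤ C ‖x‖^{-(1+κ)}` at sites of arbitrarily large norm, then
`κ ≤ 1`, by the everywhere Simon–Lieb lower bound `c ‖x‖^{-2} ≤ G(x)` on `ℤ³`. -/
theorem etaGainIO_exponent_le_one : ∀ κ C : ℝ, (∀ N : ℕ, ∃ x : Literature.Probability.LatticeModels.Site 3, (N : ℝ) < ‖x‖ ∧ Literature.Probability.LatticeModels.criticalTwoPoint 3 x ≤ C * (‖x‖ : ℝ) ^ (-(1 + κ))) → κ ≤ 1 := by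
  intro κ C h
  by_contra hκ'
  have hκ : 1 < κ := not_le.1 hκ'
  obtain ⟨c, C₀, hc, hbd⟩ := criticalTwoPoint_bounds_holds (d := 3) (by norm_num)
  -- a witness site beyond the threshold `T = (max C 1 / c)^{1/(κ-1)}` (and beyond `1`)
  set C' : ℝ := max C 1 with hC'def
  have hC'1 : 1 ≤ C' := le_max_right _ _
  have hC'0 : 0 < C' := one_pos.trans_le hC'1
  have hCC' : C ≤ C' := le_max_left _ _
  set T : ℝ := (C' / c) ^ (1 / (κ - 1)) with hTdef
  have hT0 : 0 < T := Real.rpow_pos_of_pos (div_pos hC'0 hc) _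
  obtain ⟨x, hNx, hGx⟩ := h (⌈T⌉₊ + 1)
  have hTx : T < ‖x‖ := by
    have h1 : T ≤ (⌈T⌉₊ : ℝ) := Nat.le_ceil T
    have h2 : ((⌈T⌉₊ + 1 : ℕ) : ℝ) = (⌈T⌉₊ : ℝ) + 1 := by push_cast; ring
    rw [h2] at hNx
    linarith
  have hn0 : 0 < ‖x‖ := hT0.trans hTx
  have hx0 : x ≠ 0 := fun h0 => by rw [h0, norm_zero] at hn0; exact lt_irrefl _ hn0
  -- Simon–Lieb below, the gain above: `c ‖x‖^{-2} ≤ C' ‖x‖^{-(1+κ)}`, i.e. `c ≤ C' ‖x‖^{1-κ}`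
  have hlow : c * ‖x‖ ^ (-(2 : ℝ)) ≤ criticalTwoPoint 3 x := by
    have h2 : -((3 : ℝ) - 1) = -(2 : ℝ) := by norm_num
    have := (hbd x hx0).1
    rwa [show ((3 : ℕ) : ℝ) = (3 : ℝ) by norm_num, h2] at this
  have hup : criticalTwoPoint 3 x ≤ C' * ‖x‖ ^ (-(1 + κ)) :=
    hGx.trans (mul_le_mul_of_nonneg_right hCC' (Real.rpow_nonneg hn0.le _))
  have hcle : c ≤ C' * ‖x‖ ^ (1 - κ) := by
    have h1 : c * ‖x‖ ^ (-(2 : ℝ)) ≤ C' * ‖x‖ ^ (-(1 + κ)) := hlow.trans hup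
    have h2 : 0 < ‖x‖ ^ (2 : ℝ) := Real.rpow_pos_of_pos hn0 _
    have h3 := mul_le_mul_of_nonneg_right h1 h2.le
    have h4 : c * ‖x‖ ^ (-(2 : ℝ)) * ‖x‖ ^ (2 : ℝ) = c := by
      rw [mul_assoc, ← Real.rpow_add hn0]; norm_num
    have h5 : C' * ‖x‖ ^ (-(1 + κ)) * ‖x‖ ^ (2 : ℝ) = C' * ‖x‖ ^ (1 - κ) := by
      rw [mul_assoc, ← Real.rpow_add hn0]; congr 1; congr 1; ring
    rw [h4, h5] at h3
    exact h3
  -- but `‖x‖^{1-κ} < T^{1-κ} = c / C'` since `‖x‖ > T` and `1 - κ < 0`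
  have hlt : ‖x‖ ^ (1 - κ) < T ^ (1 - κ) := Real.rpow_lt_rpow_of_neg hT0 hTx (by linarith)
  have hTpow : T ^ (1 - κ) = c / C' := by
    rw [hTdef, ← Real.rpow_mul (div_pos hC'0 hc).le]
    have hk1 : κ - 1 ≠ 0 := by linarith
    have : 1 / (κ - 1) * (1 - κ) = -1 := by field_simp; ring
    rw [this, Real.rpow_neg_one, inv_div]
  rw [hTpow] at hlt
  have : C' * ‖x‖ ^ (1 - κ) < C' * (c / C') := mul_lt_mul_of_pos_left hlt hC'0
  rw [mul_div_cancel₀ _ hC'0.ne'] at this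
  linarith

end Summit.CriticalPhenomena.Ising3DConformalLimit.AnomalousForcesInteractionEtaPositive
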